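import Mathlib
import Summits.MatrixMultiplication.MatrixMultiplication.Theorems.FidelityWitnessesFidelityGapThreeSeventeenStubBorelNormalFormLimits

/-!
# Borel normal form, part 5: the torus translate `x_v ↦ ε^{w_v} x_v`

Support file for `stub_borelNormalForm` (line `symbolic-square-border-apolarity` of
`FidelityWitnesses.FidelityGapThreeSeventeen`).  For weights `w : σ → ℕ` the substitution
`x_v ↦ ε^{w v} x_v` is a `K`-algebra endomorphism `Tw w` of the families `P[ε]` (a one-parameter torus
at `s = ε`); with complementary weights `w + w' = M` the two are mutually quasi-inverse (`= ε^{Mδ}`) on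
families of degree-`δ` polynomials.  Here: the monomial and coefficient formulas, preservation of
slice-closed pieces, the quasi-inverse, INHERITED stability (`T E T⁻¹ = ε^{shift} E` for operators
shifting the weight by a constant: `X_pow_mul_Tw_cw`), and the GAINED stability: the torus limit is
graded by `w` (`whc_mem_limW_Tw`), hence stable under every operator acting by scalars on the weight
slices (`limW_Tw_stable_diag`).  General, PROVED (CHL 2023 §2.4: "weight vectors").
-/

noncomputable section

namespace Summit.MatrixMultiplication.MatrixMultiplication.Theorems.SymbolicSquare

-- single-conjunct summit: the `Summit.<S>.<P>` prefix repeats `MatrixMultiplication` by design (D-0017)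
set_option linter.dupNamespace false

open scoped BigOperators Polynomial
open Polynomial

/-! ## The torus translate `x_v ↦ ε^{w_v} x_v`: lattice test, quasi-inverse, inherited stability and the
gradedness of the limit -/

namespace BorelLimit

universe u v

variable {K : Type u} [Field K] {σ : Type v}

section Torus

variable (w : σ → ℕ)

/-- The torus acting on coefficients: `x_v ↦ ε^{w v} x_v`, as a `K`-algebra map `P → P[ε]`. -/
def twC : MvPolynomial σ K →ₐ[K] (MvPolynomial σ K)[X] :=
  MvPolynomial.aeval fun v => monomial (w v) (MvPolynomial.X v)

/-- The torus on a monomial: `x^d ↦ ε^{w·d} x^d`. -/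
theorem twC_monomial (d : σ →₀ ℕ) (r : K) :
    twC w (MvPolynomial.monomial d r) = monomial (Finsupp.weight w d) (MvPolynomial.monomial d r) := by
  revert r
  refine Finsupp.induction d ?_ ?_
  · intro r
    rw [map_zero, monomial_zero_left, ← MvPolynomial.C_apply, twC, MvPolynomial.algHom_C, Polynomial.algebraMap_apply,
      MvPolynomial.algebraMap_eq]
  · intro v n d _ _ ih r
    rw [MvPolynomial.monomial_single_add, map_mul, map_pow, ih r, twC, MvPolynomial.aeval_X, monomial_pow,
      monomial_mul_monomial, map_add, Finsupp.weight_single, ← MvPolynomial.monomial_single_add, smul_eq_mul,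
      mul_comm (w v) n]

/-- The TORUS TRANSLATE on families: `ε ↦ ε`, `x_v ↦ ε^{w v} x_v` (a `K`-algebra endomorphism of `P[ε]`). -/
def Tw : (MvPolynomial σ K)[X] →ₐ[K] (MvPolynomial σ K)[X] := Polynomial.aevalTower (twC w) X

/-- The torus translate on a monomial family: `ε^t x^d ↦ ε^{t + w·d} x^d`. -/
theorem Tw_monomial (t : ℕ) (d : σ →₀ ℕ) (r : K) :
    Tw w (monomial t (MvPolynomial.monomial d r)) = monomial (Finsupp.weight w d + t) (MvPolynomial.monomial d r) := by
  rw [Tw, ← C_mul_X_pow_eq_monomial, map_mul, map_pow, Polynomial.aevalTower_C, Polynomial.aevalTower_X, twC_monomial,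
    monomial_mul_X_pow]

/-- The torus translate commutes with `ε`. -/
theorem Tw_X_mul (F : (MvPolynomial σ K)[X]) : Tw w (X * F) = X * Tw w F := by
  rw [map_mul, Tw, Polynomial.aevalTower_X]

/-- `Tw` as a `K`-linear map. -/
theorem Tw_toLinearMap_apply (F : (MvPolynomial σ K)[X]) : (Tw w).toLinearMap F = Tw w F := rfl

/-- **Coefficients of the torus translate**: the `s`-th coefficient of `Tw F` collects the weight slices
`weight = s - t` of the coefficients `F(t)`. -/
theorem coeff_Tw (F : (MvPolynomial σ K)[X]) (s : ℕ) :
    (Tw w F).coeff s = ∑ t ∈ Finset.range (s + 1), MvPolynomial.weightedHomogeneousComponent w (s - t) (F.coeff t) := by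
  classical
  -- reduce to monomial families by linearity in `F`
  have hgen : ∀ (t : ℕ) (g : MvPolynomial σ K), (Tw w (monomial t g)).coeff s =
      if t ≤ s then MvPolynomial.weightedHomogeneousComponent w (s - t) g else 0 := by
    intro t g
    conv_lhs => rw [← g.support_sum_monomial_coeff]
    rw [map_sum, map_sum, finsetSum_coeff]
    simp_rw [Tw_monomial, coeff_monomial]
    rw [MvPolynomial.weightedHomogeneousComponent_apply]
    split_ifs with hts
    · rw [Finset.sum_filter]
      refine Finset.sum_congr rfl fun d _ => ?_
      by_cases h : Finsupp.weight w d = s - t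
      · rw [if_pos h, if_pos (by omega)]
      · rw [if_neg h, if_neg (by omega)]
    · refine Finset.sum_eq_zero fun d _ => ?_
      rw [if_neg (by omega)]
  conv_lhs => rw [F.as_sum_support]
  rw [map_sum, finsetSum_coeff]
  simp_rw [hgen]
  rw [← Finset.sum_filter]
  have hsub : F.support.filter (fun t => t ≤ s) ⊆ Finset.range (s + 1) := by
    intro t ht
    simp only [Finset.mem_filter] at ht
    exact Finset.mem_range.2 (by omega)
  rw [Finset.sum_subset hsub]
  intro t ht hnot
  simp only [Finset.mem_filter, not_and, Polynomial.mem_support_iff, ne_eq, Finset.mem_range] at hnot ht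
  have : F.coeff t = 0 := by
    by_contra hne
    exact hnot hne (by omega)
  rw [this, map_zero]

/-- The torus translate preserves `S[ε]` for a subspace `S` stable under all weight slices. -/
theorem Tw_mem_famOf {S : Submodule K (MvPolynomial σ K)}
    (hS : ∀ j, ∀ f ∈ S, MvPolynomial.weightedHomogeneousComponent w j f ∈ S)
    {F : (MvPolynomial σ K)[X]} (hF : F ∈ famOf S) : Tw w F ∈ famOf S := by
  intro s
  rw [coeff_Tw]
  exact S.sum_mem fun t _ => hS _ _ (hF t)

/-- A weighted homogeneous submodule (for ANY weight `wt`) is stable under the weight slices of `w`. -/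
theorem whc_mem_weightedHomogeneousSubmodule {M : Type*} [AddCommMonoid M] (wt : σ → M) (m : M) (j : ℕ)
    {f : MvPolynomial σ K} (hf : f ∈ MvPolynomial.weightedHomogeneousSubmodule K wt m) :
    MvPolynomial.weightedHomogeneousComponent w j f ∈ MvPolynomial.weightedHomogeneousSubmodule K wt m := by
  classical
  rw [MvPolynomial.mem_weightedHomogeneousSubmodule] at hf ⊢
  intro d hd
  rw [MvPolynomial.coeff_weightedHomogeneousComponent] at hd
  split_ifs at hd with h
  · exact hf hd
  · exact absurd rfl hd

/-- `S[ε]` contains the monomial families `ε^n · a`, `a ∈ S`. -/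
theorem monomial_mem_famOf {S : Submodule K (MvPolynomial σ K)} (n : ℕ) {a : MvPolynomial σ K} (ha : a ∈ S) :
    monomial n a ∈ famOf S := by
  intro t
  rw [coeff_monomial]
  split_ifs
  · exact ha
  · exact S.zero_mem

/-- Families supported on a set of exponents are spanned by the monomial families `ε^t x^d`, `d ∈ s`. -/
theorem famOf_restrictSupport_le_span (s : Set (σ →₀ ℕ)) :
    famOf (MvPolynomial.restrictSupport K s) ≤ Submodule.span K
      {F | ∃ (t : ℕ) (d : σ →₀ ℕ) (r : K), d ∈ s ∧ F = monomial t (MvPolynomial.monomial d r)} := by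
  classical
  intro F hF
  rw [F.as_sum_support]
  refine Submodule.sum_mem _ fun t _ => ?_
  have ht := hF t
  rw [MvPolynomial.mem_restrictSupport_iff] at ht
  rw [← (F.coeff t).support_sum_monomial_coeff, map_sum]
  refine Submodule.sum_mem _ fun d hd => Submodule.subset_span ⟨t, d, _, ht hd, rfl⟩

/-- Two weight functions summing to the constant `M`: `w·d + w'·d = M · deg d`. -/
theorem weight_add_weight (w' : σ → ℕ) (M : ℕ) (hw : ∀ v, w v + w' v = M) (d : σ →₀ ℕ) :
    Finsupp.weight w d + Finsupp.weight w' d = M * Finsupp.degree d := by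
  rw [Finsupp.weight_apply, Finsupp.weight_apply, Finsupp.degree_eq_weight_one, Finsupp.weight_apply, Finsupp.sum,
    Finsupp.sum, Finsupp.sum, ← Finset.sum_add_distrib, Finset.mul_sum]
  refine Finset.sum_congr rfl fun v _ => ?_
  simp only [smul_eq_mul, mul_one]
  rw [← mul_add, hw v, mul_comm]

/-- **Quasi-inverse of the torus translate**: with complementary weights `w + w' = M`, on families all of
whose monomials have degree `δ`: `Tw w' (Tw w F) = ε^{M δ} F`. -/
theorem Tw_Tw_eq (w' : σ → ℕ) (M : ℕ) (hw : ∀ v, w v + w' v = M) (δ : ℕ) {F : (MvPolynomial σ K)[X]}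
    (hF : F ∈ famOf (MvPolynomial.restrictSupport K {d | Finsupp.degree d = δ})) :
    Tw w' (Tw w F) = X ^ (M * δ) * F := by
  have key : Set.EqOn ((Tw w').toLinearMap ∘ₗ (Tw w).toLinearMap) (LinearMap.mulLeft K (X ^ (M * δ)))
      {F | ∃ (t : ℕ) (d : σ →₀ ℕ) (r : K), d ∈ {d | Finsupp.degree d = δ} ∧
        F = monomial t (MvPolynomial.monomial d r)} := by
    rintro _ ⟨t, d, r, hd, rfl⟩
    simp only [Set.mem_setOf_eq] at hd
    simp only [LinearMap.comp_apply, AlgHom.toLinearMap_apply, LinearMap.mulLeft_apply]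
    rw [Tw_monomial, Tw_monomial, X_pow_mul_monomial, ← add_assoc, add_comm (Finsupp.weight w' d),
      weight_add_weight w w' M hw, hd, add_comm]
  have := LinearMap.eqOn_span' key (famOf_restrictSupport_le_span _ hF)
  simpa using this

/-- **Inherited stability under the torus** (`T E T⁻¹ = ε^{shift} E`): if `E` sends `x^d` into
`w`-weights `j'` with `j' + s₁ = w·d + s₂`, then `ε^{s₁} Tw (E F) = ε^{s₂} E (Tw F)` for every family. -/
theorem X_pow_mul_Tw_cw (E : MvPolynomial σ K →ₗ[K] MvPolynomial σ K) (s₁ s₂ : ℕ)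
    (hE : ∀ (d : σ →₀ ℕ) (r : K), E (MvPolynomial.monomial d r) ∈
      MvPolynomial.restrictSupport K {d' | Finsupp.weight w d' + s₁ = Finsupp.weight w d + s₂})
    (F : (MvPolynomial σ K)[X]) : X ^ s₁ * Tw w (cw E F) = X ^ s₂ * cw E (Tw w F) := by
  classical
  have key : Set.EqOn (LinearMap.mulLeft K (X ^ s₁) ∘ₗ (Tw w).toLinearMap ∘ₗ cw E)
      (LinearMap.mulLeft K (X ^ s₂) ∘ₗ cw E ∘ₗ (Tw w).toLinearMap)
      {F | ∃ (t : ℕ) (d : σ →₀ ℕ) (r : K), d ∈ (Set.univ : Set (σ →₀ ℕ)) ∧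
        F = monomial t (MvPolynomial.monomial d r)} := by
    rintro _ ⟨t, d, r, -, rfl⟩
    simp only [LinearMap.comp_apply, AlgHom.toLinearMap_apply, LinearMap.mulLeft_apply]
    have hcw : ∀ (n : ℕ) (g : MvPolynomial σ K), cw E (monomial n g) = monomial n (E g) := by
      intro n g
      ext i
      rw [coeff_cw, coeff_monomial, coeff_monomial]
      split_ifs <;> simp
    rw [hcw, Tw_monomial, hcw]
    set g := E (MvPolynomial.monomial d r) with hg
    have hgs := hE d r
    rw [← hg, MvPolynomial.mem_restrictSupport_iff] at hgs
    conv_lhs => rw [← g.support_sum_monomial_coeff, map_sum, map_sum, Finset.mul_sum]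
    conv_rhs => rw [← g.support_sum_monomial_coeff, map_sum, Finset.mul_sum]
    refine Finset.sum_congr rfl fun d' hd' => ?_
    have h := hgs hd'
    simp only [Set.mem_setOf_eq] at h
    rw [Tw_monomial, X_pow_mul_monomial, X_pow_mul_monomial,
      show Finsupp.weight w d' + t + s₁ = Finsupp.weight w d + t + s₂ by omega]
  have hF : F ∈ famOf (MvPolynomial.restrictSupport K (Set.univ : Set (σ →₀ ℕ))) := by
    intro t
    rw [MvPolynomial.restrictSupport_univ]
    trivial
  have := LinearMap.eqOn_span' key (famOf_restrictSupport_le_span _ hF)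
  simpa using this

/-- `Tw (G)` for a family whose coefficients are weight slices: `Tw w' (∑ₜ εᵗ (F(t))_{w = j+t}) =
ε^{Mδ-j} · (Tw w' F)(Mδ-j)` — the family used to show gradedness of the limit. Here `sliceFam`. -/
def sliceFam (j : ℕ) : (MvPolynomial σ K)[X] →ₗ[K] (MvPolynomial σ K)[X] :=
  Polynomial.lsum fun t => monK t ∘ₗ MvPolynomial.weightedHomogeneousComponent w (j + t)

/-- Coefficients of `sliceFam`. -/
theorem coeff_sliceFam (j : ℕ) (F : (MvPolynomial σ K)[X]) (t : ℕ) :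
    (sliceFam w j F).coeff t = MvPolynomial.weightedHomogeneousComponent w (j + t) (F.coeff t) := by
  classical
  simp only [sliceFam, Polynomial.lsum_apply, Polynomial.sum_def, LinearMap.comp_apply, finsetSum_coeff]
  simp only [monK, LinearMap.coe_mk, AddHom.coe_mk, coeff_monomial]
  rw [Finset.sum_ite_eq']
  split_ifs with h
  · rfl
  · rw [Polynomial.mem_support_iff, not_not] at h
    rw [h, map_zero]

/-- Weight slices for complementary weights on a degree piece: `(f)_{w' = i} = (f)_{w = Mδ - i}` when
`i ≤ Mδ`, and `= 0` when `i > Mδ`. -/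
theorem whc_compl (w' : σ → ℕ) (M : ℕ) (hw : ∀ v, w v + w' v = M) (δ : ℕ) {f : MvPolynomial σ K}
    (hf : f ∈ MvPolynomial.restrictSupport K {d | Finsupp.degree d = δ}) (i : ℕ) :
    MvPolynomial.weightedHomogeneousComponent w' i f =
      if i ≤ M * δ then MvPolynomial.weightedHomogeneousComponent w (M * δ - i) f else 0 := by
  classical
  rw [MvPolynomial.mem_restrictSupport_iff] at hf
  ext d
  rw [MvPolynomial.coeff_weightedHomogeneousComponent]
  by_cases hd : d ∈ f.support
  · have hdeg : Finsupp.degree d = δ := hf hd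
    have hsum := weight_add_weight w w' M hw d
    rw [hdeg] at hsum
    split_ifs with h1 h2 h3
    · rw [MvPolynomial.coeff_weightedHomogeneousComponent, if_pos (by omega)]
    · omega
    · rw [MvPolynomial.coeff_weightedHomogeneousComponent, if_neg (by omega)]
    · rw [MvPolynomial.coeff_zero]
  · rw [MvPolynomial.notMem_support_iff] at hd
    split_ifs <;> simp [MvPolynomial.coeff_weightedHomogeneousComponent, hd]

/-- **Gradedness of the torus limit**: for the translate tested through `Tw w'` (`w + w' = M`) on a degree
piece `S` (all monomials of degree `δ`, stable under weight slices), every weight slice of an element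
of `lim W` lies in `lim W`. -/
theorem whc_mem_limW_Tw (w' : σ → ℕ) (M : ℕ) (hw : ∀ v, w v + w' v = M) (δ : ℕ)
    {S W : Submodule K (MvPolynomial σ K)} (hSδ : S ≤ MvPolynomial.restrictSupport K {d | Finsupp.degree d = δ})
    (hS : ∀ j, ∀ f ∈ S, MvPolynomial.weightedHomogeneousComponent w j f ∈ S) (j : ℕ) :
    ∀ f ∈ limW (Tw w').toLinearMap S W,
      MvPolynomial.weightedHomogeneousComponent w j f ∈ limW (Tw w').toLinearMap S W := by
  classical
  intro f hf
  obtain ⟨F, hF, rfl⟩ := (mem_limW _).1 hf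
  by_cases hj : j ≤ M * δ
  swap
  · have : MvPolynomial.weightedHomogeneousComponent w j (F.coeff 0) = 0 := by
      apply MvPolynomial.weightedHomogeneousComponent_eq_zero'
      intro d hd
      have hdS := hSδ (hF.1 0)
      rw [MvPolynomial.mem_restrictSupport_iff] at hdS
      have hdeg : Finsupp.degree d = δ := hdS hd
      have hsum := weight_add_weight w w' M hw d
      rw [hdeg] at hsum
      omega
    rw [this]
    exact Submodule.zero_mem _
  set G := sliceFam w j F with hG
  have hGS : G ∈ famOf S := fun t => by rw [hG, coeff_sliceFam]; exact hS _ _ (hF.1 t)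
  -- the slices of the coefficients of `G`
  have hslice : ∀ s t : ℕ, t ≤ s → MvPolynomial.weightedHomogeneousComponent w' (s - t) (G.coeff t) =
      if s + j = M * δ then MvPolynomial.weightedHomogeneousComponent w (j + t) (F.coeff t) else 0 := by
    intro s t hts
    rw [hG, coeff_sliceFam]
    have hmemδ : MvPolynomial.weightedHomogeneousComponent w (j + t) (F.coeff t) ∈
        MvPolynomial.restrictSupport K {d | Finsupp.degree d = δ} := hSδ (hS _ _ (hF.1 t))
    have hmemw := MvPolynomial.weightedHomogeneousComponent_mem w (F.coeff t) (j + t)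
    rw [whc_compl w w' M hw δ hmemδ, MvPolynomial.weightedHomogeneousComponent_of_mem hmemw]
    by_cases hs : s + j = M * δ
    · rw [if_pos (by omega), if_pos (by omega), if_pos hs]
    · rw [if_neg hs]
      split_ifs with h1 h2
      · exfalso; omega
      · rfl
      · rfl
  -- `Tw w' G = ε^{Mδ - j} · (Tw w' F)(Mδ - j)`
  have hTwG : Tw w' G = monomial (M * δ - j) ((Tw w' F).coeff (M * δ - j)) := by
    apply Polynomial.ext
    intro s
    rw [coeff_Tw, coeff_monomial]
    by_cases hs : s + j = M * δ
    · rw [if_pos (by omega), coeff_Tw, show M * δ - j = s by omega]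
      refine Finset.sum_congr rfl fun t ht => ?_
      have hts : t ≤ s := Nat.lt_succ_iff.1 (Finset.mem_range.1 ht)
      rw [hslice s t hts, if_pos hs, whc_compl w w' M hw δ (hSδ (hF.1 t)), if_pos (by omega),
        show M * δ - (s - t) = j + t by omega]
    · rw [if_neg (by omega)]
      refine Finset.sum_eq_zero fun t ht => ?_
      have hts : t ≤ s := Nat.lt_succ_iff.1 (Finset.mem_range.1 ht)
      rw [hslice s t hts, if_neg hs]
  have hGlat : G ∈ lat (Tw w').toLinearMap S W := by
    refine (mem_lat _).2 ⟨hGS, ?_⟩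
    rw [AlgHom.toLinearMap_apply, hTwG]
    exact monomial_mem_famOf _ (hF.2 _)
  have h0 : G.coeff 0 = MvPolynomial.weightedHomogeneousComponent w j (F.coeff 0) := by
    rw [hG, coeff_sliceFam, add_zero]
  rw [← h0]
  exact coeff_zero_mem_limW _ hGlat

/-- Finite weight decomposition: `f = ∑_{j ≤ B} f_{w = j}` when all monomials of `f` have weight `≤ B`. -/
theorem sum_whc_eq (B : ℕ) {f : MvPolynomial σ K} (hf : ∀ d ∈ f.support, Finsupp.weight w d ≤ B) :
    ∑ j ∈ Finset.range (B + 1), MvPolynomial.weightedHomogeneousComponent w j f = f := by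
  classical
  ext d
  rw [MvPolynomial.coeff_sum]
  simp_rw [MvPolynomial.coeff_weightedHomogeneousComponent]
  rw [Finset.sum_ite_eq]
  split_ifs with h
  · rfl
  · symm
    rw [← MvPolynomial.notMem_support_iff]
    intro hd
    exact h (Finset.mem_range.2 (Nat.lt_succ_of_le (hf d hd)))

/-- **Gained stability under the torus**: an operator acting by a scalar on each weight slice of `S`
preserves the torus limit (which is graded). -/
theorem limW_Tw_stable_diag (w' : σ → ℕ) (M : ℕ) (hw : ∀ v, w v + w' v = M) (δ : ℕ)
    {S W : Submodule K (MvPolynomial σ K)} (hSδ : S ≤ MvPolynomial.restrictSupport K {d | Finsupp.degree d = δ})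
    (hS : ∀ j, ∀ f ∈ S, MvPolynomial.weightedHomogeneousComponent w j f ∈ S)
    (Δ : MvPolynomial σ K →ₗ[K] MvPolynomial σ K)
    (hΔ : ∀ j, ∃ c : K, ∀ f ∈ S, Δ (MvPolynomial.weightedHomogeneousComponent w j f) =
      c • MvPolynomial.weightedHomogeneousComponent w j f) :
    ∀ f ∈ limW (Tw w').toLinearMap S W, Δ f ∈ limW (Tw w').toLinearMap S W := by
  intro f hf
  have hfS : f ∈ S := limW_le _ hf
  have hdec : ∑ j ∈ Finset.range (M * δ + 1), MvPolynomial.weightedHomogeneousComponent w j f = f := by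
    apply sum_whc_eq
    intro d hd
    have hdS := hSδ hfS
    rw [MvPolynomial.mem_restrictSupport_iff] at hdS
    have hdeg : Finsupp.degree d = δ := hdS hd
    have hsum := weight_add_weight w w' M hw d
    rw [hdeg] at hsum
    omega
  rw [← hdec, map_sum]
  refine Submodule.sum_mem _ fun j _ => ?_
  obtain ⟨c, hc⟩ := hΔ j
  rw [hc f hfS]
  exact Submodule.smul_mem _ _ (whc_mem_limW_Tw w w' M hw δ hSδ hS j f hf)

end Torus

end BorelLimit


/-- **Part 5 of `stub_borelNormalForm` (registered helper stub): the torus limit is graded** — every weight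
slice of an element of the limit of the torus translates lies in the limit. -/
theorem stub_borelNormalForm_torus : ∀ {K : Type} [Field K] {σ : Type} (w w' : σ → ℕ) (M : ℕ),
    (∀ v, w v + w' v = M) → ∀ (δ : ℕ) {S W : Submodule K (MvPolynomial σ K)},
    S ≤ MvPolynomial.restrictSupport K {d | Finsupp.degree d = δ} →
    (∀ j, ∀ f ∈ S, MvPolynomial.weightedHomogeneousComponent w j f ∈ S) → ∀ (j : ℕ),
    ∀ f ∈ BorelLimit.limW (BorelLimit.Tw w').toLinearMap S W,
      MvPolynomial.weightedHomogeneousComponent w j f ∈ BorelLimit.limW (BorelLimit.Tw w').toLinearMap S W :=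
  fun w w' M hw δ _ _ hSδ hS j => BorelLimit.whc_mem_limW_Tw w w' M hw δ hSδ hS j

end Summit.MatrixMultiplication.MatrixMultiplication.Theorems.SymbolicSquare

end
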